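import Mathlib
import Summits.ValiantsHypothesis.ValiantsHypothesis.Theorems.NewtonUnitEquationsNewtonTauWeakCornerDefs

/-!
# `NewtonTauWeak` (stmt-ValiantsHypothesis-5904), stub `fixedKCoincidence_t2_K3`: objects of the global
# assembly (siege k9, "paper proof transcription", no short 2-vs-1 relations, `t = 2`, `K = 3`)

Route-posited objects (D-0016 `…Defs` file) for the global assembly of the `K = 3` coincidence rung of the
open stub `stub_binomialNewtonTauCommon` under the "no short 2-vs-1 relation" hypothesis
(`Cruxes/NewtonTauWeak/Lines/binomial-normal-form-ltc.md` §2, §4–§5, §7–§8):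

* the bivariate LAURENT algebra `AddMonoidAlgebra ℂ (Fin 2 → ℤ)` receives the stub's polynomial through
  `toLaurent` (exponents `ℕ² ↪ ℤ²` via `latt`); there the flip identity `1 - ρ X^d = (-ρ X^d)(1 - ρ⁻¹ X^{-d})`
  is an honest identity;
* `rayEval e R = R(X^e)` substitutes the monomial `X^e` (`e ∈ ℤ²`) into a univariate polynomial; a product of
  binomials over a common exponent list, grouped by LINES (primitive directions), is a product of `rayEval`s of
  the univariate line factors `lineR` (with flipped degree `lineDeg` and leading scalar `lineLc`);
* `sepSum` is the coefficient function of ONE separated product `Π_e V_e(X^{E_e})` as a fibre sum over the word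
  box (the one-product companion of `NewtonTauWeakCorner.fibreSum`);
* `IsInit w F v`: `v` is the `w`-initial exponent of the Laurent polynomial `F` (nonzero coefficient, every
  `w`-lighter coefficient vanishes), for a real weight `w` (`NewtonTauWeakCorner.wt`).

Everything here is a definition plus `rfl`-level API [folklore]; users: the `…NsrK9*` files of this stub.
-/

-- the namespace mandated for this Theorems file repeats the component `ValiantsHypothesis`
set_option linter.dupNamespace false

noncomputable section

open scoped BigOperators Polynomial

namespace Summit.ValiantsHypothesis.ValiantsHypothesis.Theorems.NewtonTauWeakNsrK9

open Summit.ValiantsHypothesis.ValiantsHypothesis.Theorems.NewtonTauWeakCorner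

/-! ## Lattice embedding and the Laurent algebra -/

/-- The embedding of exponents `ℕ² ↪ ℤ²`. [folklore] -/
def latt (e : Fin 2 →₀ ℕ) : Fin 2 → ℤ := fun i => (e i : ℤ)

/-- `latt` as an additive monoid homomorphism. [folklore] -/
def lattHom : (Fin 2 →₀ ℕ) →+ (Fin 2 → ℤ) where
  toFun := latt
  map_zero' := by funext i; simp [latt]
  map_add' := by intro a b; funext i; simp [latt]

/-- The bivariate polynomial ring inside the bivariate Laurent algebra `ℂ[ℤ²]`: the ring homomorphism induced
by the exponent embedding `latt`. [folklore] -/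
def toLaurent : MvPolynomial (Fin 2) ℂ →+* AddMonoidAlgebra ℂ (Fin 2 → ℤ) :=
  AddMonoidAlgebra.mapDomainRingHom ℂ lattHom

/-- Substitution of the Laurent monomial `X^e` (`e ∈ ℤ²`) into a univariate polynomial: `R ↦ R(X^e)`.
[folklore] -/
def rayEval (e : Fin 2 → ℤ) (R : ℂ[X]) : AddMonoidAlgebra ℂ (Fin 2 → ℤ) :=
  Polynomial.aeval (AddMonoidAlgebra.single e (1 : ℂ)) R

/-- `v` is the `w`-INITIAL exponent of the Laurent polynomial `F`: its coefficient is nonzero and every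
coefficient of strictly smaller real weight `⟨w,·⟩` vanishes. [folklore] -/
def IsInit (w : Fin 2 → ℝ) (F : AddMonoidAlgebra ℂ (Fin 2 → ℤ)) (v : Fin 2 → ℤ) : Prop :=
  F.coeff v ≠ 0 ∧ ∀ z, wt w z < wt w v → F.coeff z = 0

/-! ## Separated products: one-product fibre sums and univariate line factors -/

/-- The coefficient of the lattice point `z` in ONE separated product `Π_e V_e(X^{E_e})`, written as the fibre
sum of the rank-one tensor `⊗_e V_e` over the words of the box `{0,…,D}^s` pushing forward to `z`. [folklore] -/
def sepSum {s : ℕ} (E : Fin s → Fin 2 → ℤ) (D : ℕ) (V : Fin s → ℂ[X]) (z : Fin 2 → ℤ) : ℂ :=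
  ∑ n ∈ (box s D).filter (fun n => push E n = z), sepCoeff V n

/-- The univariate factor of LINE `k`: `Π_{j : ln j = k} (1 - ρ_j s^{m_j})`, for an exponent list grouped into
lines `ln : Fin N → Fin s` with multiplicities `m_j` along the line's direction. [folklore] -/
def lineR {N s : ℕ} (ρ : Fin N → ℂ) (ln : Fin N → Fin s) (m : Fin N → ℕ) (k : Fin s) : ℂ[X] :=
  ∏ j ∈ Finset.univ.filter (fun j => ln j = k), (1 - Polynomial.C (ρ j) * Polynomial.X ^ m j)

/-- The flipped degree of line `k`: total multiplicity of its ALIVE binomials (`ρ_j ≠ 0`). [folklore] -/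
def lineDeg {N s : ℕ} (ρ : Fin N → ℂ) (ln : Fin N → Fin s) (m : Fin N → ℕ) (k : Fin s) : ℕ :=
  ∑ j ∈ Finset.univ.filter (fun j => ln j = k ∧ ρ j ≠ 0), m j

/-- The flip scalar of line `k`: `Π_{j : ln j = k, ρ_j ≠ 0} (-ρ_j)`. [folklore] -/
def lineLc {N s : ℕ} (ρ : Fin N → ℂ) (ln : Fin N → Fin s) (k : Fin s) : ℂ :=
  ∏ j ∈ Finset.univ.filter (fun j => ln j = k ∧ ρ j ≠ 0), (-ρ j)

/-! ## Pattern data of the flipped normal form (global assembly) -/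

/-- The set of NEGATIVE lines of a real weight `w`: those unoriented directions `E₀ k` with `⟨w, E₀ k⟩ < 0`
(the lines whose binomials get flipped). [folklore] -/
def negLines {s : ℕ} (w : Fin 2 → ℝ) (E₀ : Fin s → Fin 2 → ℤ) : Finset (Fin s) :=
  Finset.univ.filter fun k => wt w (E₀ k) < 0

/-- Oriented direction of line `k` for the flip pattern `T` (negative lines reversed). [folklore] -/
def flipE {s : ℕ} (T : Finset (Fin s)) (E₀ : Fin s → Fin 2 → ℤ) (k : Fin s) : Fin 2 → ℤ :=
  if k ∈ T then -E₀ k else E₀ k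

/-- Univariate factor of line `k` of ONE product after the flip `T`: on a flipped line the coefficients
`ρ_j` are inverted (`1 - ρ s^m = (-ρ s^m)(1 - ρ⁻¹ s^{-m})`; `ρ = 0` stays `0`). [folklore] -/
def flipR {N s : ℕ} (T : Finset (Fin s)) (ρ : Fin N → ℂ) (ln : Fin N → Fin s) (m : Fin N → ℕ) (k : Fin s) :
    ℂ[X] :=
  if k ∈ T then lineR (fun j => (ρ j)⁻¹) ln m k else lineR ρ ln m k

/-- The CORNER of one product after the flip `T`: `Σ_{k ∈ T} lineDeg_k • E₀ k` (the `w`-lowest exponent of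
the product, its flipped binomials contributing their full degree). [folklore] -/
def cornerP {N s : ℕ} (T : Finset (Fin s)) (ρ : Fin N → ℂ) (ln : Fin N → Fin s) (m : Fin N → ℕ)
    (E₀ : Fin s → Fin 2 → ℤ) : Fin 2 → ℤ :=
  ∑ k ∈ T, (lineDeg ρ ln m k : ℤ) • E₀ k

/-- The corner SCALAR of one product after the flip `T`: `c · Π_{k ∈ T} lineLc_k`. [folklore] -/
def cornerC {N s : ℕ} (T : Finset (Fin s)) (c : ℂ) (ρ : Fin N → ℂ) (ln : Fin N → Fin s) : ℂ :=
  c * ∏ k ∈ T, lineLc ρ ln k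

/-- The ORDER SET of a line carrying the three univariate factors `R 0, R 1, R 2`: `0` together with the
`s`-adic orders `ord(R_l - R_{l'})` (as `natTrailingDegree`). [folklore] -/
def ordSet (R : Fin 3 → ℂ[X]) : Finset ℕ :=
  insert 0 ((Finset.univ ×ˢ Finset.univ).image fun ll : Fin 3 × Fin 3 => (R ll.1 - R ll.2).natTrailingDegree)

/-- The CANDIDATE SET of the local analysis: corners shifted by at most two order points on two lines,
`P_l + n₁ • E_{k₁} + n₂ • E_{k₂}` with `n_i` in the order sets. [folklore] -/
def candSet {s : ℕ} (E : Fin s → Fin 2 → ℤ) (R : Fin 3 → Fin s → ℂ[X]) (P : Fin 3 → Fin 2 → ℤ) :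
    Finset (Fin 2 → ℤ) :=
  Finset.univ.biUnion fun l : Fin 3 => Finset.univ.biUnion fun k₁ : Fin s => Finset.univ.biUnion fun k₂ : Fin s =>
    (ordSet (fun l' => R l' k₁) ×ˢ ordSet (fun l' => R l' k₂)).image
      fun nn : ℕ × ℕ => P l + (nn.1 : ℤ) • E k₁ + (nn.2 : ℤ) • E k₂

/-- Threshold pattern of the fourth quadrant (`w₀ > 0 > w₁`): lines of slope at most that of line `k`.
[folklore] -/
def thrBelow {s : ℕ} (E₀ : Fin s → Fin 2 → ℤ) (k : Fin s) : Finset (Fin s) :=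
  Finset.univ.filter fun k' => 0 < E₀ k' 1 ∧ E₀ k' 0 * E₀ k 1 ≤ E₀ k 0 * E₀ k' 1

/-- Threshold pattern of the second quadrant (`w₀ < 0 < w₁`): lines of inverse slope at most that of line
`k`. [folklore] -/
def thrAbove {s : ℕ} (E₀ : Fin s → Fin 2 → ℤ) (k : Fin s) : Finset (Fin s) :=
  Finset.univ.filter fun k' => 0 < E₀ k' 0 ∧ E₀ k' 1 * E₀ k 0 ≤ E₀ k 1 * E₀ k' 0

/-- The PATTERN SET: all possible sets of negative lines of a generic weight (`∅`, everything, or a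
threshold set), at most `2 s + 2` of them. [folklore] -/
def patternSet {s : ℕ} (E₀ : Fin s → Fin 2 → ℤ) : Finset (Finset (Fin s)) :=
  insert ∅ (insert Finset.univ (Finset.univ.image (thrBelow E₀) ∪ Finset.univ.image (thrAbove E₀)))

/-! ## Routine API -/

/-- Components of `latt`. [folklore] -/
@[simp] theorem latt_apply (e : Fin 2 →₀ ℕ) (i : Fin 2) : latt e i = (e i : ℤ) := rfl

/-- `lattHom` is `latt`. [folklore] -/
@[simp] theorem lattHom_apply (e : Fin 2 →₀ ℕ) : lattHom e = latt e := rfl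

/-- `latt` is injective. [folklore] -/
theorem latt_injective : Function.Injective latt := by
  intro a b h
  ext i
  have := congrFun h i
  simpa [latt] using this

/-- `latt` is additive. [folklore] -/
theorem latt_add (a b : Fin 2 →₀ ℕ) : latt (a + b) = latt a + latt b := lattHom.map_add a b

/-- `latt 0 = 0`. [folklore] -/
@[simp] theorem latt_zero : latt 0 = 0 := lattHom.map_zero

/-- `toLaurent` is `Finsupp.mapDomain latt` on coefficient functions. [folklore] -/
theorem coeff_toLaurent (p : MvPolynomial (Fin 2) ℂ) :
    (toLaurent p).coeff = Finsupp.mapDomain latt (AddMonoidAlgebra.coeff p) := rfl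

/-- Coefficients are transported: the coefficient of `X^{latt e}` in `toLaurent p` is `coeff e p`. [folklore] -/
theorem toLaurent_coeff_latt (p : MvPolynomial (Fin 2) ℂ) (e : Fin 2 →₀ ℕ) :
    (toLaurent p).coeff (latt e) = MvPolynomial.coeff e p := by
  rw [coeff_toLaurent, Finsupp.mapDomain_apply latt_injective]
  rfl

/-- The support is transported: `supp (toLaurent p) = latt '' supp p`. [folklore] -/
theorem support_toLaurent (p : MvPolynomial (Fin 2) ℂ) :
    (toLaurent p).coeff.support = p.support.image latt := by
  classical
  rw [coeff_toLaurent, Finsupp.mapDomain_support_of_injective latt_injective]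
  rfl

/-- `toLaurent` of a monomial. [folklore] -/
theorem toLaurent_monomial (e : Fin 2 →₀ ℕ) (a : ℂ) :
    toLaurent (MvPolynomial.monomial e a) = AddMonoidAlgebra.single (latt e) a := by
  change AddMonoidAlgebra.mapDomain lattHom (AddMonoidAlgebra.single e a) = _
  rw [AddMonoidAlgebra.mapDomain_single]
  rfl

/-- Unfolding `sepSum`. [folklore] -/
theorem sepSum_def {s : ℕ} (E : Fin s → Fin 2 → ℤ) (D : ℕ) (V : Fin s → ℂ[X]) (z : Fin 2 → ℤ) :
    sepSum E D V z = ∑ n ∈ (box s D).filter (fun n => push E n = z), sepCoeff V n := rfl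

/-- The two-product fibre sum is the corresponding combination of one-product fibre sums. [folklore] -/
theorem fibreSum_eq_sepSum {s : ℕ} (E : Fin s → Fin 2 → ℤ) (D : ℕ) (κ₁ κ₂ : ℂ) (U W : Fin s → ℂ[X])
    (z : Fin 2 → ℤ) : fibreSum E D κ₁ κ₂ U W z = κ₁ * sepSum E D U z + κ₂ * sepSum E D W z := by
  unfold fibreSum sepSum
  rw [Finset.sum_add_distrib, Finset.mul_sum, Finset.mul_sum]

/-- Unfolding `IsInit`. [folklore] -/
theorem isInit_iff (w : Fin 2 → ℝ) (F : AddMonoidAlgebra ℂ (Fin 2 → ℤ)) (v : Fin 2 → ℤ) :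
    IsInit w F v ↔ F.coeff v ≠ 0 ∧ ∀ z, wt w z < wt w v → F.coeff z = 0 := Iff.rfl

/-- Unfolding `rayEval`. [folklore] -/
theorem rayEval_def (e : Fin 2 → ℤ) (R : ℂ[X]) :
    rayEval e R = Polynomial.aeval (AddMonoidAlgebra.single e (1 : ℂ)) R := rfl

/-- `rayEval e` is a ring homomorphism: products. [folklore] -/
theorem rayEval_mul (e : Fin 2 → ℤ) (R S : ℂ[X]) : rayEval e (R * S) = rayEval e R * rayEval e S := by
  simp [rayEval]

/-- `rayEval e 1 = 1`. [folklore] -/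
@[simp] theorem rayEval_one (e : Fin 2 → ℤ) : rayEval e 1 = 1 := by simp [rayEval]

/-- `rayEval e` on a finite product. [folklore] -/
theorem rayEval_prod {ι : Type*} (e : Fin 2 → ℤ) (t : Finset ι) (R : ι → ℂ[X]) :
    rayEval e (∏ i ∈ t, R i) = ∏ i ∈ t, rayEval e (R i) := by
  simp [rayEval, map_prod]

/-- Unfolding `lineR`. [folklore] -/
theorem lineR_def {N s : ℕ} (ρ : Fin N → ℂ) (ln : Fin N → Fin s) (m : Fin N → ℕ) (k : Fin s) :
    lineR ρ ln m k = ∏ j ∈ Finset.univ.filter (fun j => ln j = k), (1 - Polynomial.C (ρ j) * Polynomial.X ^ m j) :=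
  rfl

/-- Unfolding `lineDeg`. [folklore] -/
theorem lineDeg_def {N s : ℕ} (ρ : Fin N → ℂ) (ln : Fin N → Fin s) (m : Fin N → ℕ) (k : Fin s) :
    lineDeg ρ ln m k = ∑ j ∈ Finset.univ.filter (fun j => ln j = k ∧ ρ j ≠ 0), m j := rfl

/-- Unfolding `lineLc`. [folklore] -/
theorem lineLc_def {N s : ℕ} (ρ : Fin N → ℂ) (ln : Fin N → Fin s) (k : Fin s) :
    lineLc ρ ln k = ∏ j ∈ Finset.univ.filter (fun j => ln j = k ∧ ρ j ≠ 0), (-ρ j) := rfl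

/-- Unfolding `negLines`. [folklore] -/
theorem mem_negLines {s : ℕ} (w : Fin 2 → ℝ) (E₀ : Fin s → Fin 2 → ℤ) (k : Fin s) :
    k ∈ negLines w E₀ ↔ wt w (E₀ k) < 0 := by simp [negLines]

/-- Unfolding `flipE`. [folklore] -/
theorem flipE_def {s : ℕ} (T : Finset (Fin s)) (E₀ : Fin s → Fin 2 → ℤ) (k : Fin s) :
    flipE T E₀ k = if k ∈ T then -E₀ k else E₀ k := rfl

/-- Unfolding `flipR`. [folklore] -/
theorem flipR_def {N s : ℕ} (T : Finset (Fin s)) (ρ : Fin N → ℂ) (ln : Fin N → Fin s) (m : Fin N → ℕ)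
    (k : Fin s) : flipR T ρ ln m k = if k ∈ T then lineR (fun j => (ρ j)⁻¹) ln m k else lineR ρ ln m k := rfl

/-- Unfolding `cornerP`. [folklore] -/
theorem cornerP_def {N s : ℕ} (T : Finset (Fin s)) (ρ : Fin N → ℂ) (ln : Fin N → Fin s) (m : Fin N → ℕ)
    (E₀ : Fin s → Fin 2 → ℤ) : cornerP T ρ ln m E₀ = ∑ k ∈ T, (lineDeg ρ ln m k : ℤ) • E₀ k := rfl

/-- Unfolding `cornerC`. [folklore] -/
theorem cornerC_def {N s : ℕ} (T : Finset (Fin s)) (c : ℂ) (ρ : Fin N → ℂ) (ln : Fin N → Fin s) :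
    cornerC T c ρ ln = c * ∏ k ∈ T, lineLc ρ ln k := rfl

/-- Membership in `ordSet`. [folklore] -/
theorem mem_ordSet {R : Fin 3 → ℂ[X]} {n : ℕ} :
    n ∈ ordSet R ↔ n = 0 ∨ ∃ l l' : Fin 3, n = (R l - R l').natTrailingDegree := by
  unfold ordSet
  simp only [Finset.mem_insert, Finset.mem_image, Finset.mem_product, Finset.mem_univ, true_and,
    Prod.exists]
  constructor
  · rintro (h | ⟨l, l', h⟩)
    · exact Or.inl h
    · exact Or.inr ⟨l, l', h.symm⟩
  · rintro (h | ⟨l, l', h⟩)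
    · exact Or.inl h
    · exact Or.inr ⟨l, l', h.symm⟩

/-- Membership in `candSet`. [folklore] -/
theorem mem_candSet {s : ℕ} {E : Fin s → Fin 2 → ℤ} {R : Fin 3 → Fin s → ℂ[X]} {P : Fin 3 → Fin 2 → ℤ}
    {v : Fin 2 → ℤ} :
    v ∈ candSet E R P ↔ ∃ (l : Fin 3) (k₁ k₂ : Fin s) (n₁ n₂ : ℕ), n₁ ∈ ordSet (fun l' => R l' k₁) ∧
      n₂ ∈ ordSet (fun l' => R l' k₂) ∧ v = P l + (n₁ : ℤ) • E k₁ + (n₂ : ℤ) • E k₂ := by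
  unfold candSet
  simp only [Finset.mem_biUnion, Finset.mem_univ, true_and, Finset.mem_image, Finset.mem_product,
    Prod.exists]
  constructor
  · rintro ⟨l, k₁, k₂, n₁, n₂, ⟨h1, h2⟩, h⟩
    exact ⟨l, k₁, k₂, n₁, n₂, h1, h2, h.symm⟩
  · rintro ⟨l, k₁, k₂, n₁, n₂, h1, h2, h⟩
    exact ⟨l, k₁, k₂, n₁, n₂, ⟨h1, h2⟩, h.symm⟩

/-- Unfolding `thrBelow`. [folklore] -/
theorem mem_thrBelow {s : ℕ} (E₀ : Fin s → Fin 2 → ℤ) (k k' : Fin s) :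
    k' ∈ thrBelow E₀ k ↔ 0 < E₀ k' 1 ∧ E₀ k' 0 * E₀ k 1 ≤ E₀ k 0 * E₀ k' 1 := by simp [thrBelow]

/-- Unfolding `thrAbove`. [folklore] -/
theorem mem_thrAbove {s : ℕ} (E₀ : Fin s → Fin 2 → ℤ) (k k' : Fin s) :
    k' ∈ thrAbove E₀ k ↔ 0 < E₀ k' 0 ∧ E₀ k' 1 * E₀ k 0 ≤ E₀ k 1 * E₀ k' 0 := by simp [thrAbove]

/-- Unfolding `patternSet`. [folklore] -/
theorem patternSet_def {s : ℕ} (E₀ : Fin s → Fin 2 → ℤ) : patternSet E₀ =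
    insert ∅ (insert Finset.univ (Finset.univ.image (thrBelow E₀) ∪ Finset.univ.image (thrAbove E₀))) := rfl

/-- The pattern set is small: `#patternSet ≤ 2 s + 2`. [folklore] -/
theorem k9_card_patternSet_le {s : ℕ} (E₀ : Fin s → Fin 2 → ℤ) : (patternSet E₀).card ≤ 2 * s + 2 := by
  unfold patternSet
  refine (Finset.card_insert_le _ _).trans ?_
  refine (Nat.succ_le_succ (Finset.card_insert_le _ _)).trans ?_
  have h1 : (Finset.univ.image (thrBelow E₀)).card ≤ s :=
    Finset.card_image_le.trans (by simp)
  have h2 : (Finset.univ.image (thrAbove E₀)).card ≤ s :=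
    Finset.card_image_le.trans (by simp)
  have := Finset.card_union_le (Finset.univ.image (thrBelow E₀)) (Finset.univ.image (thrAbove E₀))
  omega

end Summit.ValiantsHypothesis.ValiantsHypothesis.Theorems.NewtonTauWeakNsrK9

end
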